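import Literature.Geometry.GeometricMeasureTheory.RectifiabilityCriterion
import Literature.Geometry.GeometricMeasureTheory.SphericalMeasureImage
import Literature.Geometry.GeometricMeasureTheory.LimitSlicesRectifiable
import Literature.Geometry.GeometricMeasureTheory.LowerDensityBound
import Literature.Geometry.GeometricMeasureTheory.NormalCurrentsNullSets
import Literature.Geometry.GeometricMeasureTheory.CurrentsPolar
import HarnessLib

/-!
# Weak limits of integral cycles are carried by a countably rectifiable set

Support file for the proof of the named fact
`Literature.Geometry.GeometricMeasureTheory.Federer1969_compactness_integralCurrents` along
B. White's structure-theorem-free proof of the closure theorem [White1989, Steps 1–4]: for a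
weak limit `T` of rectifiable `(k+1)`-cycles of bounded mass supported in a fixed compact set
(and given the induction hypothesis of the slicing step, `LimitSlicesRectifiable`), the variation
measure `‖T‖` is carried by a Borel, countably `(k+1)`-rectifiable set of finite `𝓗^{k+1}`-measure.

The argument ("Run 1" of the blow-up analysis, with the spherical measure): `T` is a normal cycle
with the lower density bound `‖T‖(𝐁(x,r)) ≥ (βr)^{k+1}` a.e. (`Current.lowerDensityBound`, which
consumes the rectifiability of a.e. sphere slice `∂(T ⌞ 𝐁(x,r))`); hence the set `B` of points of
upper density `> t₀` carries `‖T‖` and has finite `𝓢^{k+1}`-measure [Federer1969, 2.10.19 (3)];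
with `σ = 𝓢^{k+1} ⌞ M` (`M` a Borel hull of `B`, minus the zero set of the density) one writes
`T = σ ∧ ξ`, `ξ ∈ L¹(σ)` (polar decomposition and Radon–Nikodym), and `σ`-a.e. point is a good
blow-up point (`ae_blowUp_hypotheses`; the sharp bound `Θ^{*(k+1)}(σ, ·) ≤ 1` holds for the
SPHERICAL measure, `ae_eventually_sphericalMeasure_inter_closedBall_le`, and orthogonal projections
do not increase `𝓢^{k+1}`, `projection_le_sphericalMeasure_restrict`); at such points the blow-ups
converge to a `(k+1)`-plane with the cone property (`tendsto_blowUp_coneCompl_of_good`), so the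
rectifiability criterion `exists_isCountablyRectifiable_of_coneDensity` applies.

* `Current.exists_eq_vectorCurrent_of_absolutelyContinuous` — `T = σ ∧ ξ` with `ξ ∈ L¹(σ)` and
  `‖T‖ = ‖ξ‖ σ` whenever `‖T‖ ≪ σ`, `σ` finite;
* `exists_sphericalCarrier_of_lowerDensity` — a finite measure with a positive lower
  `(k+1)`-density a.e. is carried by a Borel set of finite `𝓢^{k+1}`-measure;
* `ae_lowerDensity_integral_of_variation`, `eventually_mul_le_measure_closedBall` — bookkeeping
  between `‖T‖ = ‖ξ‖σ`, `σ`, and the lower density bounds;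
* **`Current.exists_rectifiable_carrier_of_slices`** — the carrier, for any `(k+1)`-CYCLE of
  finite mass and compact support whose sphere slices `∂(T ⌞ 𝐁(x,r))` are rectifiable for every
  centre and almost every radius (White's reduction "a boundaryless current with rectifiable slices
  must be rectifiable", p. 210 — no approximating sequence is needed for this half);
* **`Current.exists_rectifiable_carrier_of_tendsto_cycles`** — the carrier of a weak limit of
  rectifiable cycles (its slices are rectifiable by `LimitSlicesRectifiable`).

## References

* B. White, *A new proof of the compactness theorem for integral currents*, Comment. Math. Helv.
  64 (1989) 207–220, Steps 1–4 [White1989].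
* L. Bandara, *The closure theorem for integral currents without the structure theorem*,
  B.Sc. thesis, ANU 2006, Ch. 4 (held copy `lit paper:galaxy-pdf-8023002039701172160`)
  [Bandara2006].
* H. Federer, *Geometric Measure Theory*, Springer 1969, 2.10.19, 4.1.5, 4.1.20 [Federer1969].
-/

noncomputable section

open scoped ENNReal NNReal Topology
open MeasureTheory TopologicalSpace Set Filter Metric Function

namespace Literature.Geometry.GeometricMeasureTheory

-- Nested operator-norm instances on (duals of) `E [⋀^Fin m]→L[ℝ] ℝ`, as in `Currents.lean`.
set_option maxSynthPendingDepth 3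

variable {V : Type*} [NormedAddCommGroup V] [InnerProductSpace ℝ V] [FiniteDimensional ℝ V]
  [MeasurableSpace V] [BorelSpace V] {k : ℕ}

/-! ### `T = σ ∧ ξ` for a dominating finite measure `σ` -/

section Representation

variable {m : ℕ}

/-- **Radon–Nikodym form of the polar decomposition**: if `T` has finite mass and `‖T‖ ≪ σ` for
a finite measure `σ`, then `T = σ ∧ ξ` with `ξ = (d‖T‖/dσ) T⃗ ∈ L¹(σ)` strongly measurable and
`‖T‖ = ‖ξ‖ σ`. [cite: Federer1969, 4.1.5, 2.9.2] -/
theorem Current.exists_eq_vectorCurrent_of_absolutelyContinuous {T : Current (⊤ : Opens V) m}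
    (hT : T.mass ≠ ⊤) (σ : Measure V) [IsFiniteMeasure σ] (hσ : T.variation ≪ σ) :
    ∃ ξ : V → Multivector V m, StronglyMeasurable ξ ∧ Integrable ξ σ ∧
      T = vectorCurrent σ ξ ∧ T.variation = σ.withDensity fun x => ‖ξ x‖ₑ := by
  haveI := T.isFiniteMeasure_variation hT
  obtain ⟨τ, hτm, hτ1, hτloc, hTτ⟩ := T.exists_eq_vectorCurrent_of_mass_ne_top hT
  set ρ : V → ℝ≥0∞ := T.variation.rnDeriv σ with hρdef
  have hρm : Measurable ρ := Measure.measurable_rnDeriv _ _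
  have hρ : σ.withDensity ρ = T.variation := Measure.withDensity_rnDeriv_eq _ _ hσ
  have hρtop : ∀ᵐ x ∂σ, ρ x < ⊤ := Measure.rnDeriv_lt_top _ _
  set ξ : V → Multivector V m := fun x => (ρ x).toReal • τ x with hξdef
  have hξm : StronglyMeasurable ξ := hρm.ennreal_toReal.stronglyMeasurable.smul hτm
  -- `‖ξ‖ = ρ` a.e.
  have hτ1' : ∀ᵐ x ∂σ, ρ x ≠ 0 → ‖τ x‖ = 1 := by
    rw [← hρ, ae_withDensity_iff hρm] at hτ1
    exact hτ1
  have hnorm : ∀ᵐ x ∂σ, ‖ξ x‖ = (ρ x).toReal := by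
    filter_upwards [hτ1'] with x hx
    by_cases h0 : ρ x = 0
    · simp [hξdef, h0]
    · rw [hξdef]
      dsimp only
      rw [norm_smul, Real.norm_of_nonneg ENNReal.toReal_nonneg, hx h0, mul_one]
  have hint : Integrable (fun x => (ρ x).toReal) σ := by
    refine integrable_toReal_of_lintegral_ne_top hρm.aemeasurable ?_
    have : ∫⁻ x, ρ x ∂σ = T.variation univ := by
      rw [← hρ, withDensity_apply _ MeasurableSet.univ, Measure.restrict_univ]
    rw [this]
    exact measure_ne_top _ _
  have hξi : Integrable ξ σ :=
    hint.mono' hξm.aestronglyMeasurable (hnorm.mono fun x hx => hx.le)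
  refine ⟨ξ, hξm, hξi, ?_, ?_⟩
  · rw [hTτ]
    ext φ
    rw [vectorCurrent_apply hτloc, vectorCurrent_apply (hξi.locallyIntegrable.locallyIntegrableOn _)]
    have h1 : ∫ x, τ x (φ x) ∂T.variation = ∫ x, τ x (φ x) ∂(σ.withDensity ρ) := by rw [hρ]
    rw [h1, integral_withDensity_eq_integral_toReal_smul hρm hρtop]
    exact integral_congr_ae (Eventually.of_forall fun x => rfl)
  · rw [← hρ]
    refine withDensity_congr_ae ?_
    filter_upwards [hnorm, hρtop] with x hx hxtop
    rw [← ofReal_norm, hx, ENNReal.ofReal_toReal hxtop.ne]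

/-- **Restricting to the support of the density**: if `T = σ ∧ ξ` with `‖T‖ = ‖ξ‖σ` then also
`T = σ' ∧ ξ` and `‖T‖ = ‖ξ‖σ'` for `σ' = σ ⌞ {ξ ≠ 0}`, and `σ' ≪ ‖T‖`. [cite: Federer1969, 4.1.5] -/
theorem vectorCurrent_restrict_support_density {σ : Measure V} {ξ : V → Multivector V m}
    (hξm : StronglyMeasurable ξ) {T : Current (⊤ : Opens V) m} (hTξ : T = vectorCurrent σ ξ)
    (hvar : T.variation = σ.withDensity fun x => ‖ξ x‖ₑ) :
    T = vectorCurrent (σ.restrict {x | ξ x ≠ 0}) ξ ∧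
      T.variation = (σ.restrict {x | ξ x ≠ 0}).withDensity (fun x => ‖ξ x‖ₑ) ∧
      σ.restrict {x | ξ x ≠ 0} ≪ T.variation := by
  have hS : MeasurableSet {x | ξ x ≠ 0} := (hξm.measurableSet_eq_fun stronglyMeasurable_const).compl
  have hind : {x | ξ x ≠ 0}.indicator ξ = ξ := by
    funext x
    by_cases hx : ξ x ≠ 0
    · exact indicator_of_mem hx ξ
    · rw [indicator_of_notMem hx]
      exact (not_not.1 hx).symm
  refine ⟨?_, ?_, ?_⟩
  · rw [hTξ, ← vectorCurrent_indicator ξ hS, hind]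
  · rw [hvar, ← restrict_withDensity hS]
    refine (Measure.restrict_eq_self_of_ae_mem ?_).symm
    rw [ae_withDensity_iff hξm.enorm]
    exact Eventually.of_forall fun x hx => by
      rwa [mem_setOf_eq, ne_eq, ← enorm_eq_zero]
  · rw [hvar]
    intro A hA
    rw [withDensity_apply_eq_zero' hξm.enorm.aemeasurable] at hA
    rw [Measure.restrict_apply' hS]
    refine measure_mono_null (fun x hx => ?_) hA
    refine ⟨?_, hx.1⟩
    rw [mem_setOf_eq, ne_eq, enorm_eq_zero]
    exact hx.2

/-- The mass of balls as an integral: `‖T‖(A) = ∫_A ‖ξ‖ dσ` when `‖T‖ = ‖ξ‖σ`, `ξ ∈ L¹(σ)`.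
[cite: Federer1969, 4.1.5] -/
theorem variation_toReal_eq_setIntegral {σ : Measure V} {ξ : V → Multivector V m}
    (hξ : Integrable ξ σ) {T : Current (⊤ : Opens V) m}
    (hvar : T.variation = σ.withDensity fun x => ‖ξ x‖ₑ) {A : Set V} (hA : MeasurableSet A) :
    (T.variation A).toReal = ∫ x in A, ‖ξ x‖ ∂σ := by
  rw [hvar, withDensity_apply _ hA, integral_norm_eq_lintegral_enorm hξ.1.restrict]

end Representation

/-! ### A carrier of finite spherical measure from a lower density bound -/

section Carrier

/-- **A lower density bound gives a carrier of finite `𝓢^{k+1}`-measure**: if `μ` is finite and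
`μ(𝐁(x,r)) ≥ (βr)^{k+1}` for small `r` at `μ`-a.e. `x`, then `Θ^{*(k+1)}(μ, x) ≥ β^{k+1}/α(k+1)`
there, so `μ` is carried by the set of points of upper density `> β^{k+1}/(2α(k+1))`, which has
finite `𝓢^{k+1}`-measure by the density comparison theorem; take a Borel hull.
[cite: Federer1969, 2.10.19 (3), 2.10.6] -/
theorem exists_sphericalCarrier_of_lowerDensity (μ : Measure V) [IsFiniteMeasure μ] {β : ℝ}
    (hβ : 0 < β)
    (hlow : ∀ᵐ x ∂μ, ∀ᶠ r in 𝓝[>] (0 : ℝ),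
      ENNReal.ofReal ((β * r) ^ (k + 1)) ≤ μ (closedBall x r)) :
    ∃ M₀ : Set V, MeasurableSet M₀ ∧ (sphericalMeasure (k + 1) : Measure V) M₀ ≠ ⊤ ∧ μ M₀ᶜ = 0 := by
  set α : ℝ≥0∞ := unitBallVolume (k + 1) with hα
  have hα0 : α ≠ 0 := unitBallVolume_ne_zero _
  have hαT : α ≠ ⊤ := unitBallVolume_ne_top _
  set t₁ : ℝ≥0∞ := ENNReal.ofReal (β ^ (k + 1)) / α with ht₁
  have ht₁0 : t₁ ≠ 0 := (ENNReal.div_pos_iff.2 ⟨(ENNReal.ofReal_pos.2 (by positivity)).ne', hαT⟩).ne'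
  have ht₁T : t₁ ≠ ⊤ := ENNReal.div_ne_top ENNReal.ofReal_ne_top hα0
  set t₀ : ℝ≥0∞ := t₁ / 2 with ht₀
  have ht₀0 : t₀ ≠ 0 := (ENNReal.div_pos_iff.2 ⟨ht₁0, ENNReal.ofNat_ne_top⟩).ne'
  have ht₀T : t₀ ≠ ⊤ := ENNReal.div_ne_top ht₁T two_ne_zero
  have ht₀1 : t₀ < t₁ := ENNReal.half_lt_self ht₁0 ht₁T
  set B : Set V := {x | t₀ < upperDensity (k + 1) μ x} with hB
  -- `μ` is carried by `B`
  have hBae : ∀ᵐ x ∂μ, x ∈ B := by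
    filter_upwards [hlow] with x hx
    have hev : ∀ᶠ r in 𝓝[>] (0 : ℝ), t₁ ≤ μ (closedBall x r) / (α * ENNReal.ofReal (r ^ (k + 1))) := by
      filter_upwards [hx, self_mem_nhdsWithin] with r hr hr0
      rw [mem_Ioi] at hr0
      have hrk : ENNReal.ofReal (r ^ (k + 1)) ≠ 0 := (ENNReal.ofReal_pos.2 (by positivity)).ne'
      rw [ht₁, ENNReal.le_div_iff_mul_le (Or.inl (mul_ne_zero hα0 hrk))
        (Or.inl (ENNReal.mul_ne_top hαT ENNReal.ofReal_ne_top))]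
      calc ENNReal.ofReal (β ^ (k + 1)) / α * (α * ENNReal.ofReal (r ^ (k + 1)))
          = ENNReal.ofReal (β ^ (k + 1)) * ENNReal.ofReal (r ^ (k + 1)) := by
            rw [← mul_assoc, ENNReal.div_mul_cancel hα0 hαT]
        _ = ENNReal.ofReal ((β * r) ^ (k + 1)) := by
            rw [← ENNReal.ofReal_mul (by positivity), mul_pow]
        _ ≤ μ (closedBall x r) := hr
    have h1 : t₁ ≤ upperDensity (k + 1) μ x := le_limsup_of_frequently_le hev.frequently
    exact lt_of_lt_of_le ht₀1 h1
  -- `B` has finite Hausdorff and spherical measure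
  have hH : μH[(k + 1 : ℕ)] B ≠ ⊤ := by
    have h := mul_hausdorffMeasure_le_of_lt_upperDensity μ (k + 1) isOpen_univ (subset_univ B)
      fun x hx => hx
    have hne : t₀ * α ≠ 0 := mul_ne_zero ht₀0 hα0
    have hneT : t₀ * α ≠ ⊤ := ENNReal.mul_ne_top ht₀T hαT
    have h2 : μH[(k + 1 : ℕ)] B ≤ 8 ^ (k + 1) * μ univ / (t₀ * α) := by
      rw [ENNReal.le_div_iff_mul_le (Or.inl hne) (Or.inl hneT), mul_comm]
      exact h
    exact ne_top_of_le_ne_top (ENNReal.div_ne_top (ENNReal.mul_ne_top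
      (ENNReal.pow_ne_top ENNReal.ofNat_ne_top) (measure_ne_top _ _)) hne) h2
  have hS : (sphericalMeasure (k + 1) : Measure V) B ≠ ⊤ :=
    ne_top_of_le_ne_top (ENNReal.mul_ne_top hαT hH) (sphericalMeasure_le_mul_hausdorffMeasure _ _)
  refine ⟨toMeasurable (sphericalMeasure (k + 1) : Measure V) B, measurableSet_toMeasurable _ _,
    by rwa [measure_toMeasurable], ?_⟩
  have hB0 : μ Bᶜ = 0 := ae_iff.1 hBae
  exact measure_mono_null (compl_subset_compl.2 (subset_toMeasurable _ _)) hB0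

end Carrier

/-! ### Lower density bounds: from `‖T‖` to `σ` -/

section LowerDensity

variable {σ : Measure V} {ξ : V → Multivector V (k + 1)}

/-- The lower density bound for `‖T‖ = ‖ξ‖σ` in integral form, `σ`-a.e., when `σ ≪ ‖T‖`.
[cite: White1989, p. 213; Federer1969, 4.1.5] -/
theorem ae_setIntegral_lowerDensity [IsFiniteMeasure σ] (hξ : Integrable ξ σ)
    {T : Current (⊤ : Opens V) (k + 1)} (hvar : T.variation = σ.withDensity fun x => ‖ξ x‖ₑ)
    (hσT : σ ≪ T.variation) {β : ℝ} (hβ : 0 < β)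
    (hlow : ∀ᵐ x ∂T.variation, ∀ᶠ r in 𝓝[>] (0 : ℝ),
      ENNReal.ofReal ((β * r) ^ (k + 1)) ≤ T.variation (closedBall x r)) :
    ∀ᵐ x ∂σ, ∀ᶠ r in 𝓝[>] (0 : ℝ), (β * r) ^ (k + 1) ≤ ∫ x' in closedBall x r, ‖ξ x'‖ ∂σ := by
  have hfin : ∀ A : Set V, T.variation A ≠ ⊤ := by
    intro A
    rw [hvar]
    refine ne_top_of_le_ne_top ?_ (measure_mono (subset_univ A))
    rw [withDensity_apply _ MeasurableSet.univ, Measure.restrict_univ]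
    exact hξ.2.ne
  filter_upwards [hσT.ae_le hlow] with x hx
  filter_upwards [hx, self_mem_nhdsWithin] with r hr hr0
  rw [mem_Ioi] at hr0
  rw [← variation_toReal_eq_setIntegral hξ hvar measurableSet_closedBall,
    ← ENNReal.toReal_ofReal (by have := hβ.le; positivity : (0 : ℝ) ≤ (β * r) ^ (k + 1))]
  exact ENNReal.toReal_mono (hfin _) hr

omit [FiniteDimensional ℝ V] in
/-- **The lower density of `σ` at a Lebesgue point**: if `(βr)^{k+1} ≤ ∫_{𝐁(a,r)} ‖ξ‖ dσ` for small
`r`, `a` is a normalised Lebesgue point of `ξ` and `ξ(a) ≠ 0`, then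
`σ(𝐁(a, r)) ≥ (β^{k+1}/(2‖ξ(a)‖)) r^{k+1}` for small `r`. [cite: White1989, p. 217;
Bandara2006, Lemma 4.1.8] -/
theorem eventually_mul_le_measure_closedBall [IsFiniteMeasure σ] (hξ : Integrable ξ σ) {a : V}
    {β : ℝ} (hβ : 0 < β)
    (hAa : ∀ᶠ r in 𝓝[>] (0 : ℝ), (β * r) ^ (k + 1) ≤ ∫ x in closedBall a r, ‖ξ x‖ ∂σ)
    (hLeb : Tendsto (fun r => (r⁻¹) ^ (k + 1) * ∫ x in closedBall a r, ‖ξ x - ξ a‖ ∂σ)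
      (𝓝[>] 0) (𝓝 0))
    (hξa : ξ a ≠ 0) :
    ∀ᶠ r in 𝓝[>] (0 : ℝ), ENNReal.ofReal (β ^ (k + 1) / (2 * ‖ξ a‖)) *
      ENNReal.ofReal (r ^ (k + 1)) ≤ σ (closedBall a r) := by
  have hξa' : 0 < ‖ξ a‖ := norm_pos_iff.2 hξa
  have hpos : (0 : ℝ) < β ^ (k + 1) / 2 := by positivity
  filter_upwards [hAa, hLeb.eventually (gt_mem_nhds hpos), self_mem_nhdsWithin] with r hr hL hr0
  rw [mem_Ioi] at hr0
  have hrk : (0 : ℝ) < r ^ (k + 1) := by positivity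
  -- `∫_𝐁 ‖ξ‖ ≤ ‖ξ(a)‖ σ(𝐁) + ∫_𝐁 ‖ξ − ξ(a)‖`
  have hint1 : IntegrableOn (fun x => ‖ξ x‖) (closedBall a r) σ := hξ.norm.integrableOn
  have hsub : Integrable (fun x => ‖ξ x - ξ a‖) σ := (hξ.sub' (integrable_const _)).norm
  have hint2 : IntegrableOn (fun x => ‖ξ a‖ + ‖ξ x - ξ a‖) (closedBall a r) σ :=
    ((integrable_const (‖ξ a‖)).add hsub).integrableOn
  have h1 : ∫ x in closedBall a r, ‖ξ x‖ ∂σ ≤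
      ‖ξ a‖ * (σ (closedBall a r)).toReal + ∫ x in closedBall a r, ‖ξ x - ξ a‖ ∂σ := by
    calc ∫ x in closedBall a r, ‖ξ x‖ ∂σ ≤ ∫ x in closedBall a r, (‖ξ a‖ + ‖ξ x - ξ a‖) ∂σ :=
          setIntegral_mono_on hint1 hint2 measurableSet_closedBall fun x _ => norm_le_insert' _ _
      _ = ‖ξ a‖ * (σ (closedBall a r)).toReal + ∫ x in closedBall a r, ‖ξ x - ξ a‖ ∂σ := by
          rw [integral_add (integrable_const _).integrableOn hsub.integrableOn, setIntegral_const,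
            smul_eq_mul, mul_comm, Measure.real]
  -- `∫_𝐁 ‖ξ − ξ(a)‖ ≤ (β^{k+1}/2) r^{k+1}`
  have h2 : ∫ x in closedBall a r, ‖ξ x - ξ a‖ ∂σ ≤ β ^ (k + 1) / 2 * r ^ (k + 1) := by
    have h := hL.le
    rw [inv_pow, inv_mul_le_iff₀ hrk] at h
    linarith
  have h3 : β ^ (k + 1) / (2 * ‖ξ a‖) * r ^ (k + 1) ≤ (σ (closedBall a r)).toReal := by
    rw [div_mul_eq_mul_div, div_le_iff₀ (mul_pos two_pos hξa')]
    have : (β * r) ^ (k + 1) = β ^ (k + 1) * r ^ (k + 1) := mul_pow β r (k + 1)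
    nlinarith
  rw [← ENNReal.ofReal_mul (by positivity)]
  exact (ENNReal.ofReal_le_ofReal h3).trans ENNReal.ofReal_toReal_le

end LowerDensity

/-! ### The carrier -/

section Main

/-- **`‖T‖` is carried by a countably `(k+1)`-rectifiable set** for a `(k+1)`-cycle `T` of finite
mass with compact support whose sphere slices `∂(T ⌞ 𝐁(x,r))` are rectifiable currents for every
centre `x` and almost every radius `r > 0` (White: "the proof … will be reduced to showing that a
boundaryless current with rectifiable slices must be rectifiable", p. 210; [White1989, Steps 1–4],
Run 1 of the blow-up analysis with `σ = 𝓢^{k+1} ⌞ M`). No approximating sequence and no induction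
hypothesis enter this half of the argument. [cite: White1989, pp. 210–220; Bandara2006, Thm. 4.2.1] -/
theorem Current.exists_rectifiable_carrier_of_slices (hkn : k + 1 ≤ Module.finrank ℝ V)
    {T' : Current (⊤ : Opens V) (k + 1)} (hT'm : T'.mass ≠ ⊤) (hT'0 : T'.boundary = 0)
    (hT'c : IsCompact T'.support)
    (hslices : ∀ x, ∀ᵐ r : ℝ, 0 < r →
      ((T'.isRepresentable_of_mass_ne_top hT'm).restrictSet (closedBall x r)
        measurableSet_closedBall).boundary.IsRectifiable) :
    ∃ M₁ : Set V, MeasurableSet M₁ ∧ IsCountablyRectifiable (k + 1) M₁ ∧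
      (μHE[k + 1] : Measure V) M₁ ≠ ⊤ ∧ T'.variation M₁ᶜ = 0 := by
  classical
  -- Step 0: `T'` is a normal cycle of finite mass with compact support
  have hdT' : T'.boundary.mass ≠ ⊤ := by rw [hT'0, Current.mass_zero]; exact ENNReal.zero_ne_top
  haveI : IsFiniteMeasure T'.variation := T'.isFiniteMeasure_variation hT'm
  -- Step 1: the lower density bound from the rectifiable sphere slices
  obtain ⟨β, hβ, hlow⟩ : ∃ β : ℝ, 0 < β ∧ ∀ᵐ x ∂T'.variation, ∀ᶠ r in 𝓝[>] (0 : ℝ),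
      ENNReal.ofReal ((β * r) ^ (k + 1)) ≤ T'.variation (closedBall x r) := by
    cases k with
    | zero =>
      obtain ⟨β, hβ, h⟩ := Current.lowerDensityBound_one (V := V)
      refine ⟨β, hβ, ?_⟩
      have h' := h T' hT'm hT'0 (ae_of_all _ hslices)
      simpa only [zero_add, pow_one] using h'
    | succ k' =>
      obtain ⟨β, hβ, h⟩ := Current.lowerDensityBound (V := V) k' (by omega)
      exact ⟨β, hβ, h T' hT'm hT'0 (ae_of_all _ hslices)⟩
  -- Step 2: a carrier of finite spherical measure, and `σ₀ = 𝓢 ⌞ M₀`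
  obtain ⟨M₀, hM₀m, hM₀fin, hM₀null⟩ :=
    exists_sphericalCarrier_of_lowerDensity (k := k) T'.variation hβ hlow
  set 𝓢 : Measure V := (sphericalMeasure (k + 1) : Measure V) with h𝓢
  have hHE : ∀ A : Set V, (μHE[k + 1] : Measure V) A ≤
      ((Measure.addHaarScalarFactor (volume : Measure (EuclideanSpace ℝ (Fin (k + 1))))
        (μH[((k + 1 : ℕ) : ℝ)] : Measure (EuclideanSpace ℝ (Fin (k + 1)))) : ℝ≥0) : ℝ≥0∞) *
        ((2 : ℝ≥0∞) ^ (k + 1) * (unitBallVolume (k + 1))⁻¹ * 𝓢 A) := by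
    intro A
    rw [Measure.euclideanHausdorffMeasure_def, Measure.smul_apply, ENNReal.smul_def, smul_eq_mul]
    gcongr
    exact hausdorffMeasure_le_mul_sphericalMeasure (k + 1) A
  have hHEfin : ∀ A : Set V, 𝓢 A ≠ ⊤ → (μHE[k + 1] : Measure V) A ≠ ⊤ := fun A hA =>
    ne_top_of_le_ne_top (ENNReal.mul_ne_top ENNReal.coe_ne_top (ENNReal.mul_ne_top
      (ENNReal.mul_ne_top (ENNReal.pow_ne_top ENNReal.ofNat_ne_top)
        (ENNReal.inv_ne_top.2 (unitBallVolume_ne_zero _))) hA)) (hHE A)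
  have hHEnull : ∀ A : Set V, 𝓢 A = 0 → (μHE[k + 1] : Measure V) A = 0 := fun A hA =>
    nonpos_iff_eq_zero.1 ((hHE A).trans (by simp only [hA, mul_zero, le_refl]))
  haveI hσ₀fin : IsFiniteMeasure (𝓢.restrict M₀) := isFiniteMeasure_restrict.2 hM₀fin
  have hac₀ : T'.variation ≪ 𝓢.restrict M₀ := by
    intro A hA
    rw [Measure.restrict_apply' hM₀m] at hA
    have h1 : T'.variation (A ∩ M₀) = 0 :=
      T'.variation_eq_zero_of_euclideanHausdorffMeasure_eq_zero hT'm hdT' hT'c (hHEnull _ hA)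
    refine nonpos_iff_eq_zero.1 ?_
    calc T'.variation A ≤ T'.variation (A ∩ M₀ ∪ M₀ᶜ) :=
          measure_mono fun x hx => by
            by_cases h : x ∈ M₀
            · exact Or.inl ⟨hx, h⟩
            · exact Or.inr h
      _ ≤ T'.variation (A ∩ M₀) + T'.variation M₀ᶜ := measure_union_le _ _
      _ = 0 := by rw [h1, hM₀null, add_zero]
  -- Step 3: `T' = σ ∧ ξ` with `σ = 𝓢 ⌞ M`, `M = M₀ ∩ {ξ ≠ 0}`
  obtain ⟨ξ, hξm, hξi₀, hTξ₀, hvar₀⟩ :=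
    T'.exists_eq_vectorCurrent_of_absolutelyContinuous hT'm (𝓢.restrict M₀) hac₀
  have hSm : MeasurableSet {x : V | ξ x ≠ 0} :=
    (hξm.measurableSet_eq_fun stronglyMeasurable_const).compl
  set M : Set V := {x : V | ξ x ≠ 0} ∩ M₀ with hMdef
  have hMm : MeasurableSet M := hSm.inter hM₀m
  set σ : Measure V := 𝓢.restrict M with hσdef
  have hσeq : (𝓢.restrict M₀).restrict {x : V | ξ x ≠ 0} = σ := by
    rw [hσdef, hMdef, Measure.restrict_restrict hSm]
  obtain ⟨hTξ, hvar, hσT⟩ := vectorCurrent_restrict_support_density hξm hTξ₀ hvar₀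
  rw [hσeq] at hTξ hvar hσT
  have hMfin : 𝓢 M ≠ ⊤ := ne_top_of_le_ne_top hM₀fin (measure_mono inter_subset_right)
  haveI hσfin : IsFiniteMeasure σ := isFiniteMeasure_restrict.2 hMfin
  have hξi : Integrable ξ σ := by
    rw [← hσeq]; exact hξi₀.restrict
  have hTσv : T'.variation ≪ σ := by rw [hvar]; exact withDensity_absolutelyContinuous _ _
  -- Step 4: the hypotheses of the blow-up analysis hold `σ`-a.e.
  have hA : ∀ᵐ x ∂σ, ∀ᶠ r in 𝓝[>] (0 : ℝ),
      (β * r) ^ (k + 1) ≤ ∫ x' in closedBall x r, ‖ξ x'‖ ∂σ :=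
    ae_setIntegral_lowerDensity hξi hvar hσT hβ hlow
  have hup : ∀ᵐ x ∂σ, ∀ t : ℝ≥0∞, 1 < t → ∀ᶠ r in 𝓝[>] (0 : ℝ),
      σ (closedBall x r) ≤ t * (unitBallVolume (k + 1) * ENNReal.ofReal (r ^ (k + 1))) := by
    filter_upwards [ae_eventually_sphericalMeasure_inter_closedBall_le (n := k + 1) hMm hMfin]
      with x hx t ht
    filter_upwards [hx t ht] with r hr
    rwa [hσdef, Measure.restrict_apply measurableSet_closedBall, inter_comm]
  have hgood := ae_blowUp_hypotheses hξi hβ hA hup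
  have hTcyc : (vectorCurrent σ ξ : Current (⊤ : Opens V) (k + 1)).boundary = 0 := by
    rw [← hTξ]; exact hT'0
  have hMc : σ Mᶜ = 0 := by
    rw [hσdef, Measure.restrict_apply hMm.compl, compl_inter_self, measure_empty]
  have hproj := projection_le_sphericalMeasure_restrict (k := k) (V := V) M
  -- Step 5: the cone property at a.e. point, and the rectifiability criterion
  have hcone : ∀ᵐ a ∂σ, ∃ W : Submodule ℝ V, Module.finrank ℝ W = k + 1 ∧
      (∃ c₀ : ℝ≥0∞, c₀ ≠ 0 ∧
        ∀ᶠ r in 𝓝[>] (0 : ℝ), c₀ * ENNReal.ofReal (r ^ (k + 1)) ≤ σ (closedBall a r)) ∧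
      ∀ s : ℝ, 0 < s → Tendsto (fun r : ℝ => ENNReal.ofReal ((r⁻¹) ^ (k + 1)) *
        σ {x | ‖x - a‖ ≤ r ∧ s * ‖x - a‖ ≤ ‖Wᗮ.starProjection (x - a)‖}) (𝓝[>] 0) (𝓝 0) := by
    filter_upwards [hgood, hA] with a ha hAa
    obtain ⟨hLeb, ⟨j, haj, hdens⟩, hξa, ⟨Kg, hKg, hgrowth⟩, hupa⟩ := ha
    have hr₁ : (0 : ℝ) < ((j : ℝ) + 1)⁻¹ := by positivity
    have hM' : ∀ x ∈ lowerDensitySet σ ξ β ((j : ℝ) + 1)⁻¹, ∀ r, 0 < r → r ≤ ((j : ℝ) + 1)⁻¹ →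
        (β * r) ^ (k + 1) ≤ ∫ x' in closedBall x r, ‖ξ x'‖ ∂σ := fun x hx => mem_lowerDensitySet.1 hx
    obtain ⟨ι₀, ν₀, hι₀, hν₀, hv₀⟩ := Measure.exists_subseq_vagueTendsto_blowUp σ (m := k + 1) hKg
      hgrowth (r := fun n : ℕ => ((n : ℝ) + 1)⁻¹) (fun n => by positivity)
    haveI := hν₀
    have hdim : Module.finrank ℝ (ξ a).invariantSubspace = k + 1 :=
      (blowUpLimit_eq_restrict_invariantSubspace hξi hTcyc hMc hproj
        (lam := fun l => ((ι₀ l : ℝ) + 1)⁻¹) (fun l => by positivity)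
        ((tendsto_one_div_add_atTop_nhds_zero_nat.congr fun n => one_div _).comp hι₀.tendsto_atTop)
        hv₀ hLeb hβ hr₁ haj hM' hdens hξa hupa).1
    refine ⟨(ξ a).invariantSubspace, hdim, ⟨ENNReal.ofReal (β ^ (k + 1) / (2 * ‖ξ a‖)),
      (ENNReal.ofReal_pos.2 (div_pos (pow_pos hβ _) (mul_pos two_pos (norm_pos_iff.2 hξa)))).ne',
      eventually_mul_le_measure_closedBall hξi hβ hAa hLeb hξa⟩, fun s hs => ?_⟩
    exact tendsto_blowUp_coneCompl_of_good hξi hTcyc hMc hproj hLeb hβ hr₁ haj hM' hdens hξa hKg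
      hgrowth hupa hs
  obtain ⟨M₁, hM₁m, hM₁r, hM₁null⟩ := exists_isCountablyRectifiable_of_coneDensity σ hcone
  -- Step 6: the carrier `M₁ ∩ M`
  refine ⟨M₁ ∩ M, hM₁m.inter hMm, hM₁r.mono inter_subset_left,
    hHEfin _ (ne_top_of_le_ne_top hMfin (measure_mono inter_subset_right)), ?_⟩
  rw [compl_inter]
  refine nonpos_iff_eq_zero.1 ((measure_union_le _ _).trans ?_)
  rw [hTσv hM₁null, hTσv hMc, add_zero]

/-- **`‖T‖` is carried by a countably `(k+1)`-rectifiable set** for a weak limit `T` of rectifiable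
`(k+1)`-cycles of bounded mass supported in a compact set, given the induction hypothesis that
weak limits of rectifiable `k`-dimensional boundaries of bounded mass and support are rectifiable
([White1989, Steps 1–4]; Run 1 of the blow-up analysis, with `σ = 𝓢^{k+1} ⌞ M`): the limit is a
normal cycle whose sphere slices are rectifiable (`LimitSlicesRectifiable`), so
`Current.exists_rectifiable_carrier_of_slices` applies.
[cite: White1989, pp. 211–220; Bandara2006, Thm. 4.2.1] -/
theorem Current.exists_rectifiable_carrier_of_tendsto_cycles (hkn : k + 1 ≤ Module.finrank ℝ V)
    (IH : ∀ (K' : Set V), IsCompact K' → ∀ (c' : ℝ≥0∞), c' ≠ ⊤ →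
      ∀ (Q : ℕ → Current (⊤ : Opens V) (k + 1)) (Z' : Current (⊤ : Opens V) k),
        (∀ i, (Q i).boundary.IsRectifiable ∧ (Q i).boundary.support ⊆ K' ∧
          (Q i).boundary.mass ≤ c') →
        (∀ φ, Tendsto (fun i => (Q i).boundary φ) atTop (𝓝 (Z' φ))) → Z'.IsRectifiable)
    {K : Set V} (hK : IsCompact K) {c : ℝ≥0∞} (hc : c ≠ ⊤)
    {T : ℕ → Current (⊤ : Opens V) (k + 1)} {T' : Current (⊤ : Opens V) (k + 1)}
    (hT : ∀ i, (T i).IsRectifiable ∧ (T i).boundary = 0 ∧ (T i).support ⊆ K ∧ (T i).mass ≤ c)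
    (hconv : ∀ φ, Tendsto (fun i => T i φ) atTop (𝓝 (T' φ))) :
    ∃ M₁ : Set V, MeasurableSet M₁ ∧ IsCountablyRectifiable (k + 1) M₁ ∧
      (μHE[k + 1] : Measure V) M₁ ≠ ⊤ ∧ T'.variation M₁ᶜ = 0 := by
  -- `T'` is a normal cycle of finite mass with compact support
  have hT'm : T'.mass ≠ ⊤ :=
    ne_top_of_le_ne_top hc (Current.mass_le_of_tendsto hconv fun i => (hT i).2.2.2)
  have hT'0 : T'.boundary = 0 :=
    Current.boundary_eq_zero_of_tendsto (l := atTop) hconv fun i => (hT i).2.1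
  have hT'K : T'.support ⊆ K :=
    Current.support_subset_of_tendsto hconv hK.isClosed fun i => (hT i).2.2.1
  have hT'c : IsCompact T'.support := T'.isCompact_support_of_subset hK (subset_univ _) hT'K
  -- a.e. sphere slice of `T'` is rectifiable
  have hslices : ∀ x, ∀ᵐ r : ℝ, 0 < r →
      ((T'.isRepresentable_of_mass_ne_top hT'm).restrictSet (closedBall x r)
        measurableSet_closedBall).boundary.IsRectifiable :=
    fun x => Current.ae_isRectifiable_boundary_piece_of_tendsto hkn IH hK hc hT hconv hT'm x
  exact Current.exists_rectifiable_carrier_of_slices hkn hT'm hT'0 hT'c hslices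

end Main

end Literature.Geometry.GeometricMeasureTheory
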